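import Literature.Analysis.PDE.NewtonianPotential
import Mathlib.Analysis.Calculus.UniformLimitsDeriv
import HarnessLib

/-!
# The Newtonian kernel of a finite-dimensional real inner product space (`n ≥ 3`), III:
# regularity of the Newtonian potential (Gilbarg–Trudinger Lemmas 4.1–4.2)

Analysis/PDE support file (PROVED theorems only; no definitions of substance, no named facts),
continuation of `NewtonianKernel.lean` / `NewtonianPotential.lean` on the discharge path of
`Literature.Analysis.PDE.LoewnerNirenberg.exists_isMaximalSolution`.

* **N1** (Gilbarg–Trudinger Lemma 4.1): for a bounded integrable density `g` supported in a
  ball, `N g ∈ C¹(E)` with `D(N g)(x) = ∫ g z • DΓ(x - z) dz = potentialGrad 0 g x`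
  (`hasFDerivAt_potential`, `contDiff_one_potential`). Proof: the differences
  `|N_a g - N_b g|`, `‖D N_a g - D N_b g‖` on a ball are bounded by `M` times the single
  integrals `∫_S |Γ_a - Γ_b|`, `∫_S ‖DΓ_a - DΓ_b‖` over a larger ball `S`
  (`abs_potential_sub_le`, `norm_potentialGrad_sub_le`), which tend to `0` as `a → 0⁺` by
  dominated convergence (`tendsto_setIntegral_abs_kernel_sub`,
  `tendsto_setIntegral_norm_fderiv_kernel_sub`); so `N_a g → N g` and `D N_a g → potentialGrad 0 g`
  uniformly on balls, and Mathlib's `hasFDerivAt_of_tendstoUniformlyOn` applies along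
  `aₘ = (m+1)⁻¹`.
* **Truncation**: near `x₀`, `N_a h (x) = ∫ (χΓ_a)(t) h(x - t) dt` with a compactly supported
  integrable truncated kernel (`truncKernel`, `potential_eq_integral_truncKernel`), so the
  density-side differentiation lemmas of `FluidPDE/HarmonicProbe` give `N_a g ∈ C^m` for
  `g ∈ C^m_c` and `Δ N_a g = N_a Δg` (`contDiff_potential_of_contDiff`,
  `laplacian_potential_of_contDiff_two`).
* **N2** (Gilbarg–Trudinger Lemma 4.2 in the easy `C²` case): `Δ (N g) = g` for `g ∈ C²` with
  `tsupport g ⊆ B(c,R)` (`laplacian_potential_eq_self`):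
  `Δ N g = N Δg = lim_{ε→0⁺} N_{ε²} Δg = lim Δ N_{ε²} g = lim ρ_{ε²} * g = g`.
* **N3**: `N g ∈ C²` for `g ∈ C¹` with `tsupport g ⊆ B(c,R)` (`contDiff_two_potential`:
  `∂ᵥ N g = N ∂ᵥ g ∈ C¹` by N1).

## References

* D. Gilbarg, N. S. Trudinger, *Elliptic Partial Differential Equations of Second Order*
  (Springer 2001), §4.1 Lemmas 4.1–4.2. [GilbargTrudinger2001]
-/

noncomputable section

open MeasureTheory Metric Set Filter Function Module InnerProductSpace
open scoped Laplacian RealInnerProductSpace Topology ContDiff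

namespace Literature.Analysis.PDE

namespace Newtonian

variable {E : Type*} [NormedAddCommGroup E] [InnerProductSpace ℝ E] [FiniteDimensional ℝ E]
  [MeasurableSpace E] [BorelSpace E]

/-! ### N1. Uniform convergence of the regularised potentials; `N g ∈ C¹` -/

section N1

variable {g : E → ℝ} {c : E} {R M : ℝ}

omit [InnerProductSpace ℝ E] [FiniteDimensional ℝ E] [MeasurableSpace E] [BorelSpace E] in
/-- For `x ∈ B(x₀, ρ)` and `z ∈ B(c, R)`, `x - z ∈ B(x₀ - c, ρ + R)`. [folklore] -/
theorem sub_mem_ball_of_mem_ball {x x₀ z c : E} {ρ R : ℝ} (hx : x ∈ ball x₀ ρ) (hz : z ∈ ball c R) :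
    x - z ∈ ball (x₀ - c) (ρ + R) := by
  rw [mem_ball, dist_eq_norm] at hx hz ⊢
  calc ‖x - z - (x₀ - c)‖ = ‖(x - x₀) - (z - c)‖ := by abel_nf
    _ ≤ ‖x - x₀‖ + ‖z - c‖ := norm_sub_le _ _
    _ < ρ + R := add_lt_add hx hz

/-- **Reduction of the difference of potentials to a single integral**: for `x ∈ B(x₀, ρ)`,
`|N_a g x - N_b g x| ≤ M ∫_{B(x₀ - c, ρ + R)} |Γ_a - Γ_b|`. [folklore] -/
theorem abs_potential_sub_le (hn : 3 ≤ finrank ℝ E) {a b : ℝ} (ha : 0 ≤ a) (hb : 0 ≤ b)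
    (hg : Integrable g) (hgM : ∀ z, |g z| ≤ M) (hsupp : ∀ z ∉ ball c R, g z = 0)
    {x₀ : E} {ρ : ℝ} {x : E} (hx : x ∈ ball x₀ ρ) :
    |potential a g x - potential b g x| ≤
      M * ∫ ξ in ball (x₀ - c) (ρ + R), |kernel a ξ - kernel b ξ| := by
  have hM0 : 0 ≤ M := (abs_nonneg _).trans (hgM x)
  set S : Set E := ball (x₀ - c) (ρ + R) with hS
  set F : E → ℝ := fun ξ => |kernel a ξ - kernel b ξ| with hF
  have hT : MeasurePreserving (fun z : E => x - z) volume volume :=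
    Measure.measurePreserving_sub_left volume x
  have he : MeasurableEmbedding (fun z : E => x - z) := (Homeomorph.subLeft x).measurableEmbedding
  -- integrability of the kernels on the ball `S`
  have h2k : 2 * expo E < finrank ℝ E := by rw [two_mul_expo]; linarith
  have hKint : ∀ {a' : ℝ}, 0 ≤ a' → IntegrableOn (kernel a' : E → ℝ) S := by
    intro a' ha'
    have hdom : IntegrableOn (fun ξ : E => (bumpMass E)⁻¹ * ‖ξ‖ ^ (-(2 * expo E))) S :=
      (integrableOn_norm_rpow_neg_of_isBounded hn h2k isBounded_ball).const_mul _
    refine hdom.mono' (measurable_kernel a').aestronglyMeasurable ?_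
    rw [ae_restrict_iff' measurableSet_ball]
    filter_upwards [ae_ne hn (0 : E)] with ξ hξ _
    rw [Real.norm_eq_abs]
    calc |kernel a' ξ| ≤ |kernel 0 ξ| := abs_kernel_le_abs_kernel_zero (by omega) ha' hξ
      _ = (bumpMass E)⁻¹ * ‖ξ‖ ^ (-(2 * expo E)) := abs_kernel_zero_eq hn ξ
  have hFint : IntegrableOn F S := ((hKint ha).sub (hKint hb)).abs
  have hFT : IntegrableOn (fun z => F (x - z)) ((fun z : E => x - z) ⁻¹' S) :=
    (hT.integrableOn_comp_preimage he).2 hFint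
  -- pointwise bound by the indicator of the preimage
  have hsub : ball c R ⊆ (fun z : E => x - z) ⁻¹' S := fun z hz => sub_mem_ball_of_mem_ball hx hz
  have hbound : ∀ z, |g z * (kernel a (x - z) - kernel b (x - z))| ≤
      M * ((fun z : E => x - z) ⁻¹' S).indicator (fun z => F (x - z)) z := by
    intro z
    by_cases hz : z ∈ ball c R
    · rw [indicator_of_mem (hsub hz), abs_mul, hF]
      exact mul_le_mul_of_nonneg_right (hgM z) (abs_nonneg _)
    · rw [hsupp z hz, zero_mul, abs_zero]
      exact mul_nonneg hM0 (indicator_nonneg (fun w _ => abs_nonneg _) z)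
  have hdiff : potential a g x - potential b g x = ∫ z, g z * (kernel a (x - z) - kernel b (x - z)) := by
    unfold potential
    rw [← integral_sub (integrable_mul_kernel hn ha hg hgM hsupp x)
      (integrable_mul_kernel hn hb hg hgM hsupp x)]
    refine integral_congr_ae (Eventually.of_forall fun z => ?_)
    ring
  rw [hdiff]
  have hI : Integrable fun z => g z * (kernel a (x - z) - kernel b (x - z)) := by
    have := (integrable_mul_kernel hn ha hg hgM hsupp x).sub (integrable_mul_kernel hn hb hg hgM hsupp x)
    refine this.congr (Eventually.of_forall fun z => ?_)
    simp only [Pi.sub_apply]; ring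
  calc |∫ z, g z * (kernel a (x - z) - kernel b (x - z))|
      ≤ ∫ z, |g z * (kernel a (x - z) - kernel b (x - z))| := abs_integral_le_integral_abs
    _ ≤ ∫ z, M * ((fun z : E => x - z) ⁻¹' S).indicator (fun z => F (x - z)) z :=
        integral_mono hI.abs ((hFT.integrable_indicator (he.measurable measurableSet_ball)).const_mul M)
          hbound
    _ = M * ∫ ξ in S, F ξ := by
        rw [integral_const_mul, integral_indicator (he.measurable measurableSet_ball),
          hT.setIntegral_preimage_emb he F S]

/-- The same reduction for the gradient potentials:
`‖∫ g • DΓ_a(x - ·) - ∫ g • DΓ_b(x - ·)‖ ≤ M ∫_{B(x₀ - c, ρ + R)} ‖DΓ_a - DΓ_b‖`. [folklore] -/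
theorem norm_potentialGrad_sub_le (hn : 3 ≤ finrank ℝ E) {a b : ℝ} (ha : 0 ≤ a) (hb : 0 ≤ b)
    (hg : Integrable g) (hgM : ∀ z, |g z| ≤ M) (hsupp : ∀ z ∉ ball c R, g z = 0)
    {x₀ : E} {ρ : ℝ} {x : E} (hx : x ∈ ball x₀ ρ) :
    ‖potentialGrad a g x - potentialGrad b g x‖ ≤
      M * ∫ ξ in ball (x₀ - c) (ρ + R),
        ‖fderiv ℝ (kernel a : E → ℝ) ξ - fderiv ℝ (kernel b : E → ℝ) ξ‖ := by
  have hM0 : 0 ≤ M := (abs_nonneg _).trans (hgM x)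
  set S : Set E := ball (x₀ - c) (ρ + R) with hS
  set F : E → ℝ := fun ξ => ‖fderiv ℝ (kernel a : E → ℝ) ξ - fderiv ℝ (kernel b : E → ℝ) ξ‖ with hF
  have hT : MeasurePreserving (fun z : E => x - z) volume volume :=
    Measure.measurePreserving_sub_left volume x
  have he : MeasurableEmbedding (fun z : E => x - z) := (Homeomorph.subLeft x).measurableEmbedding
  have h2k1 : 2 * expo E + 1 < finrank ℝ E := by rw [two_mul_expo]; linarith
  have hKint : ∀ {a' : ℝ}, 0 ≤ a' → IntegrableOn (fderiv ℝ (kernel a' : E → ℝ)) S := by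
    intro a' ha'
    have hdom : IntegrableOn
        (fun ξ : E => 2 * expo E * (bumpMass E)⁻¹ * ‖ξ‖ ^ (-(2 * expo E + 1))) S :=
      (integrableOn_norm_rpow_neg_of_isBounded hn h2k1 isBounded_ball).const_mul _
    refine hdom.mono' (measurable_fderiv_kernel a').aestronglyMeasurable ?_
    rw [ae_restrict_iff' measurableSet_ball]
    filter_upwards [ae_ne hn (0 : E)] with ξ hξ _
    exact norm_fderiv_kernel_le hn ha' hξ
  have hFint : IntegrableOn F S := ((hKint ha).sub (hKint hb)).norm
  have hFT : IntegrableOn (fun z => F (x - z)) ((fun z : E => x - z) ⁻¹' S) :=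
    (hT.integrableOn_comp_preimage he).2 hFint
  have hsub : ball c R ⊆ (fun z : E => x - z) ⁻¹' S := fun z hz => sub_mem_ball_of_mem_ball hx hz
  have hbound : ∀ z, ‖g z • (fderiv ℝ (kernel a : E → ℝ) (x - z) - fderiv ℝ (kernel b : E → ℝ) (x - z))‖
      ≤ M * ((fun z : E => x - z) ⁻¹' S).indicator (fun z => F (x - z)) z := by
    intro z
    by_cases hz : z ∈ ball c R
    · rw [indicator_of_mem (hsub hz), norm_smul, Real.norm_eq_abs, hF]
      exact mul_le_mul_of_nonneg_right (hgM z) (norm_nonneg _)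
    · rw [hsupp z hz, zero_smul, norm_zero]
      exact mul_nonneg hM0 (indicator_nonneg (fun w _ => norm_nonneg _) z)
  have hIa := integrable_smul_fderiv_kernel hn ha hg hgM hsupp x
  have hIb := integrable_smul_fderiv_kernel hn hb hg hgM hsupp x
  have hdiff : potentialGrad a g x - potentialGrad b g x =
      ∫ z, g z • (fderiv ℝ (kernel a : E → ℝ) (x - z) - fderiv ℝ (kernel b : E → ℝ) (x - z)) := by
    unfold potentialGrad
    rw [← integral_sub hIa hIb]
    refine integral_congr_ae (Eventually.of_forall fun z => ?_)
    simp only [smul_sub]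
  rw [hdiff]
  have hI : Integrable fun z => g z • (fderiv ℝ (kernel a : E → ℝ) (x - z) -
      fderiv ℝ (kernel b : E → ℝ) (x - z)) :=
    (hIa.sub hIb).congr (Eventually.of_forall fun z => by simp only [Pi.sub_apply, smul_sub])
  calc ‖∫ z, g z • (fderiv ℝ (kernel a : E → ℝ) (x - z) - fderiv ℝ (kernel b : E → ℝ) (x - z))‖
      ≤ ∫ z, ‖g z • (fderiv ℝ (kernel a : E → ℝ) (x - z) - fderiv ℝ (kernel b : E → ℝ) (x - z))‖ :=
        norm_integral_le_integral_norm _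
    _ ≤ ∫ z, M * ((fun z : E => x - z) ⁻¹' S).indicator (fun z => F (x - z)) z :=
        integral_mono hI.norm ((hFT.integrable_indicator (he.measurable measurableSet_ball)).const_mul M)
          hbound
    _ = M * ∫ ξ in S, F ξ := by
        rw [integral_const_mul, integral_indicator (he.measurable measurableSet_ball),
          hT.setIntegral_preimage_emb he F S]

/-- **`∫_S |Γ_a - Γ| → 0` as `a → 0⁺`** on every ball `S` (dominated convergence, dominated by
`2|Γ|`). [folklore] -/
theorem tendsto_setIntegral_abs_kernel_sub (hn : 3 ≤ finrank ℝ E) (c₀ : E) (r : ℝ) :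
    Tendsto (fun a : ℝ => ∫ ξ in ball c₀ r, |kernel a ξ - kernel 0 ξ|) (𝓝[>] 0) (𝓝 0) := by
  have h2k : 2 * expo E < finrank ℝ E := by rw [two_mul_expo]; linarith
  have hdom : IntegrableOn (fun ξ : E => 2 * ((bumpMass E)⁻¹ * ‖ξ‖ ^ (-(2 * expo E)))) (ball c₀ r) :=
    (integrableOn_norm_rpow_neg_of_isBounded hn h2k isBounded_ball).const_mul _ |>.const_mul _
  have hae : ∀ᵐ ξ : E ∂(volume.restrict (ball c₀ r)), ξ ≠ 0 := by
    rw [ae_restrict_iff' measurableSet_ball]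
    filter_upwards [ae_ne hn (0 : E)] with ξ hξ _ using hξ
  have key := tendsto_integral_filter_of_dominated_convergence
    (μ := volume.restrict (ball c₀ r)) (l := 𝓝[>] (0 : ℝ))
    (F := fun a ξ => |kernel a ξ - kernel 0 ξ|) (f := fun _ => (0 : ℝ))
    (fun ξ : E => 2 * ((bumpMass E)⁻¹ * ‖ξ‖ ^ (-(2 * expo E)))) ?_ ?_ hdom ?_
  · simpa using key
  · exact Eventually.of_forall fun a =>
      (((measurable_kernel a).sub (measurable_kernel 0)).norm).aestronglyMeasurable
  · filter_upwards [self_mem_nhdsWithin] with a (ha : 0 < a)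
    filter_upwards [hae] with ξ hξ
    rw [Real.norm_eq_abs, abs_abs]
    calc |kernel a ξ - kernel 0 ξ| ≤ |kernel a ξ| + |kernel 0 ξ| := abs_sub _ _
      _ ≤ |kernel 0 ξ| + |kernel 0 ξ| :=
          add_le_add (abs_kernel_le_abs_kernel_zero (by omega) ha.le hξ) le_rfl
      _ = 2 * ((bumpMass E)⁻¹ * ‖ξ‖ ^ (-(2 * expo E))) := by rw [abs_kernel_zero_eq hn ξ]; ring
  · filter_upwards [hae] with ξ hξ
    have h := (tendsto_kernel_nhdsWithin_zero (E := E) hξ).mono_left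
      (nhdsWithin_mono _ Ioi_subset_Ici_self)
    have : Tendsto (fun a : ℝ => kernel a ξ - kernel 0 ξ) (𝓝[>] 0) (𝓝 0) := by
      simpa using h.sub_const (kernel 0 ξ)
    simpa using this.abs

/-- **`∫_S ‖DΓ_a - DΓ‖ → 0` as `a → 0⁺`** on every ball `S`. [folklore] -/
theorem tendsto_setIntegral_norm_fderiv_kernel_sub (hn : 3 ≤ finrank ℝ E) (c₀ : E) (r : ℝ) :
    Tendsto (fun a : ℝ => ∫ ξ in ball c₀ r,
      ‖fderiv ℝ (kernel a : E → ℝ) ξ - fderiv ℝ (kernel 0 : E → ℝ) ξ‖) (𝓝[>] 0) (𝓝 0) := by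
  have h2k1 : 2 * expo E + 1 < finrank ℝ E := by rw [two_mul_expo]; linarith
  set C : ℝ := 2 * expo E * (bumpMass E)⁻¹ with hC
  have hdom : IntegrableOn (fun ξ : E => 2 * (C * ‖ξ‖ ^ (-(2 * expo E + 1)))) (ball c₀ r) :=
    (integrableOn_norm_rpow_neg_of_isBounded hn h2k1 isBounded_ball).const_mul _ |>.const_mul _
  have hae : ∀ᵐ ξ : E ∂(volume.restrict (ball c₀ r)), ξ ≠ 0 := by
    rw [ae_restrict_iff' measurableSet_ball]
    filter_upwards [ae_ne hn (0 : E)] with ξ hξ _ using hξ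
  have key := tendsto_integral_filter_of_dominated_convergence
    (μ := volume.restrict (ball c₀ r)) (l := 𝓝[>] (0 : ℝ))
    (F := fun a ξ => ‖fderiv ℝ (kernel a : E → ℝ) ξ - fderiv ℝ (kernel 0 : E → ℝ) ξ‖)
    (f := fun _ => (0 : ℝ)) (fun ξ : E => 2 * (C * ‖ξ‖ ^ (-(2 * expo E + 1)))) ?_ ?_ hdom ?_
  · simpa using key
  · exact Eventually.of_forall fun a =>
      (((measurable_fderiv_kernel a).sub (measurable_fderiv_kernel 0)).norm).aestronglyMeasurable
  · filter_upwards [self_mem_nhdsWithin] with a (ha : 0 < a)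
    filter_upwards [hae] with ξ hξ
    rw [norm_norm]
    calc ‖fderiv ℝ (kernel a : E → ℝ) ξ - fderiv ℝ (kernel 0 : E → ℝ) ξ‖
        ≤ ‖fderiv ℝ (kernel a : E → ℝ) ξ‖ + ‖fderiv ℝ (kernel 0 : E → ℝ) ξ‖ := norm_sub_le _ _
      _ ≤ C * ‖ξ‖ ^ (-(2 * expo E + 1)) + C * ‖ξ‖ ^ (-(2 * expo E + 1)) :=
          add_le_add (norm_fderiv_kernel_le hn ha.le hξ) (norm_fderiv_kernel_le hn le_rfl hξ)
      _ = 2 * (C * ‖ξ‖ ^ (-(2 * expo E + 1))) := by ring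
  · filter_upwards [hae] with ξ hξ
    have h := (tendsto_fderiv_kernel_nhdsWithin_zero (E := E) hξ).mono_left
      (nhdsWithin_mono _ Ioi_subset_Ici_self)
    have : Tendsto (fun a : ℝ => fderiv ℝ (kernel a : E → ℝ) ξ - fderiv ℝ (kernel 0 : E → ℝ) ξ)
        (𝓝[>] 0) (𝓝 0) := by
      simpa using h.sub_const (fderiv ℝ (kernel 0 : E → ℝ) ξ)
    simpa using this.norm

/-- **Uniform convergence `N_a g → N g` on balls** as `a → 0⁺`. [folklore] -/
theorem tendstoUniformlyOn_potential (hn : 3 ≤ finrank ℝ E) (hg : Integrable g)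
    (hgM : ∀ z, |g z| ≤ M) (hsupp : ∀ z ∉ ball c R, g z = 0) (x₀ : E) (ρ : ℝ) :
    TendstoUniformlyOn (fun a => potential a g) (potential 0 g) (𝓝[>] 0) (ball x₀ ρ) := by
  have hM0 : 0 ≤ M := (abs_nonneg _).trans (hgM x₀)
  rw [Metric.tendstoUniformlyOn_iff]
  intro η hη
  have ht := tendsto_setIntegral_abs_kernel_sub hn (x₀ - c) (ρ + R)
  set D : ℝ → ℝ := fun a => ∫ ξ in ball (x₀ - c) (ρ + R), |kernel a ξ - kernel 0 ξ| with hDdef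
  have hev : ∀ᶠ a in 𝓝[>] (0 : ℝ), |D a| < η / (M + 1) := by
    have := (Metric.tendsto_nhds.1 ht) (η / (M + 1)) (by positivity)
    simpa [Real.dist_eq] using this
  filter_upwards [hev, self_mem_nhdsWithin] with a ha (ha0 : 0 < a) x hx
  rw [Real.dist_eq, abs_sub_comm]
  have h1 := abs_potential_sub_le hn ha0.le le_rfl hg hgM hsupp hx
  have hD : 0 ≤ D a := integral_nonneg fun ξ => abs_nonneg _
  rw [abs_of_nonneg hD] at ha
  calc |potential a g x - potential 0 g x| ≤ M * D a := h1
    _ ≤ (M + 1) * D a := mul_le_mul_of_nonneg_right (by linarith) hD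
    _ < (M + 1) * (η / (M + 1)) := mul_lt_mul_of_pos_left ha (by linarith)
    _ = η := by field_simp

/-- **Uniform convergence of the gradient potentials on balls** as `a → 0⁺`. [folklore] -/
theorem tendstoUniformlyOn_potentialGrad (hn : 3 ≤ finrank ℝ E) (hg : Integrable g)
    (hgM : ∀ z, |g z| ≤ M) (hsupp : ∀ z ∉ ball c R, g z = 0) (x₀ : E) (ρ : ℝ) :
    TendstoUniformlyOn (fun a => potentialGrad a g) (potentialGrad 0 g) (𝓝[>] 0) (ball x₀ ρ) := by
  have hM0 : 0 ≤ M := (abs_nonneg _).trans (hgM x₀)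
  rw [Metric.tendstoUniformlyOn_iff]
  intro η hη
  have ht := tendsto_setIntegral_norm_fderiv_kernel_sub hn (x₀ - c) (ρ + R)
  set D : ℝ → ℝ := fun a => ∫ ξ in ball (x₀ - c) (ρ + R),
    ‖fderiv ℝ (kernel a : E → ℝ) ξ - fderiv ℝ (kernel 0 : E → ℝ) ξ‖ with hDdef
  have hev : ∀ᶠ a in 𝓝[>] (0 : ℝ), |D a| < η / (M + 1) := by
    have := (Metric.tendsto_nhds.1 ht) (η / (M + 1)) (by positivity)
    simpa [Real.dist_eq] using this
  filter_upwards [hev, self_mem_nhdsWithin] with a ha (ha0 : 0 < a) x hx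
  rw [dist_eq_norm, norm_sub_rev]
  have h1 := norm_potentialGrad_sub_le hn ha0.le le_rfl hg hgM hsupp hx
  have hD : 0 ≤ D a := integral_nonneg fun ξ => norm_nonneg _
  rw [abs_of_nonneg hD] at ha
  calc ‖potentialGrad a g x - potentialGrad 0 g x‖ ≤ M * D a := h1
    _ ≤ (M + 1) * D a := mul_le_mul_of_nonneg_right (by linarith) hD
    _ < (M + 1) * (η / (M + 1)) := mul_lt_mul_of_pos_left ha (by linarith)
    _ = η := by field_simp

omit [InnerProductSpace ℝ E] [FiniteDimensional ℝ E] [MeasurableSpace E] [BorelSpace E] in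
/-- Reindexing a uniform convergence along a map of index filters. [folklore] -/
theorem _root_.TendstoUniformlyOn.comp_tendsto' {ι κ X Y : Type*} [UniformSpace Y]
    {F : ι → X → Y} {f : X → Y} {p : Filter ι} {s : Set X} (h : TendstoUniformlyOn F f p s)
    {q : Filter κ} {u : κ → ι} (hu : Tendsto u q p) :
    TendstoUniformlyOn (fun k => F (u k)) f q s :=
  fun U hU => hu.eventually (h U hU)

/-- The sequence `aₘ = (m+1)⁻¹ → 0⁺`. [folklore] -/
theorem tendsto_inv_succ_nhdsWithin :
    Tendsto (fun m : ℕ => ((m : ℝ) + 1)⁻¹) atTop (𝓝[>] (0 : ℝ)) := by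
  refine tendsto_nhdsWithin_iff.2 ⟨?_, Eventually.of_forall fun m => ?_⟩
  · simpa only [one_div] using tendsto_one_div_add_atTop_nhds_zero_nat (𝕜 := ℝ)
  · show 0 < ((m : ℝ) + 1)⁻¹
    positivity

/-- **N1 (Gilbarg–Trudinger Lemma 4.1). The Newtonian potential of a bounded integrable
density supported in a ball is differentiable, `D(N g)(x) = ∫ g(z) • DΓ(x - z) dz`.**
[cite: GilbargTrudinger2001, Lemma 4.1] -/
theorem hasFDerivAt_potential (hn : 3 ≤ finrank ℝ E) (hg : Integrable g) (hgM : ∀ z, |g z| ≤ M)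
    (hsupp : ∀ z ∉ ball c R, g z = 0) (x : E) :
    HasFDerivAt (potential 0 g) (potentialGrad 0 g x) x := by
  set u : ℕ → ℝ := fun m => ((m : ℝ) + 1)⁻¹ with hu
  have hu0 : ∀ m, 0 < u m := fun m => by rw [hu]; positivity
  have hut : Tendsto u atTop (𝓝[>] (0 : ℝ)) := tendsto_inv_succ_nhdsWithin
  refine hasFDerivAt_of_tendstoUniformlyOn (l := (atTop : Filter ℕ)) (f := fun m => potential (u m) g)
    (f' := fun m => potentialGrad (u m) g) isOpen_ball ?_ ?_ ?_ (mem_ball_self (zero_lt_one' ℝ))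
  · exact (tendstoUniformlyOn_potentialGrad hn hg hgM hsupp x 1).comp_tendsto' hut
  · exact fun m y _ => hasFDerivAt_potential_pos (hu0 m) hg hsupp y
  · intro y hy
    exact ((tendstoUniformlyOn_potential hn hg hgM hsupp x 1).comp_tendsto' hut).tendsto_at hy

/-- **N1 (continued)**: the gradient potential `x ↦ ∫ g(z) • DΓ(x - z) dz` is continuous (a
locally uniform limit of the continuous `D(N_a g)`). [cite: GilbargTrudinger2001, Lemma 4.1] -/
theorem continuous_potentialGrad (hn : 3 ≤ finrank ℝ E) (hg : Integrable g)
    (hgM : ∀ z, |g z| ≤ M) (hsupp : ∀ z ∉ ball c R, g z = 0) :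
    Continuous (potentialGrad 0 g) := by
  refine continuous_iff_continuousAt.2 fun x => ?_
  have h := tendstoUniformlyOn_potentialGrad hn hg hgM hsupp x 1
  have hc : ContinuousOn (potentialGrad 0 g) (ball x 1) := by
    refine h.continuousOn (Filter.Eventually.frequently ?_)
    filter_upwards [self_mem_nhdsWithin] with a (ha : 0 < a)
    exact (continuous_potentialGrad_pos ha hg hsupp).continuousOn
  exact hc.continuousAt (isOpen_ball.mem_nhds (mem_ball_self one_pos))

/-- `D(N g) = potentialGrad 0 g` as functions. [folklore] -/
theorem fderiv_potential (hn : 3 ≤ finrank ℝ E) (hg : Integrable g) (hgM : ∀ z, |g z| ≤ M)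
    (hsupp : ∀ z ∉ ball c R, g z = 0) : fderiv ℝ (potential 0 g) = potentialGrad 0 g :=
  funext fun x => (hasFDerivAt_potential hn hg hgM hsupp x).fderiv

/-- **N1 (conclusion): `N g ∈ C¹(E)`** for a bounded integrable density supported in a ball
(`n ≥ 3`). [cite: GilbargTrudinger2001, Lemma 4.1] -/
theorem contDiff_one_potential (hn : 3 ≤ finrank ℝ E) (hg : Integrable g) (hgM : ∀ z, |g z| ≤ M)
    (hsupp : ∀ z ∉ ball c R, g z = 0) : ContDiff ℝ 1 (potential 0 g) := by
  rw [contDiff_one_iff_fderiv]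
  refine ⟨fun x => (hasFDerivAt_potential hn hg hgM hsupp x).differentiableAt, ?_⟩
  rw [fderiv_potential hn hg hgM hsupp]
  exact continuous_potentialGrad hn hg hgM hsupp

/-- Pointwise convergence `N_a g (x) → N g (x)` as `a → 0⁺`. [folklore] -/
theorem tendsto_potential (hn : 3 ≤ finrank ℝ E) (hg : Integrable g) (hgM : ∀ z, |g z| ≤ M)
    (hsupp : ∀ z ∉ ball c R, g z = 0) (x : E) :
    Tendsto (fun a : ℝ => potential a g x) (𝓝[>] 0) (𝓝 (potential 0 g x)) :=
  (tendstoUniformlyOn_potential hn hg hgM hsupp x 1).tendsto_at (mem_ball_self one_pos)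

end N1

/-! ### N2, N3. Smooth densities: `Δ N g = N Δ g = g`, `N g ∈ C²` for `g ∈ C¹_c` -/

section N2

variable {g : E → ℝ} {c : E} {R : ℝ}

/-- The truncation radius at `x₀` for densities supported in `B(c, R)`. [folklore] -/
def truncRadius (x₀ c : E) (R : ℝ) : ℝ := ‖x₀‖ + 1 + (‖c‖ + |R|)

omit [InnerProductSpace ℝ E] [FiniteDimensional ℝ E] [MeasurableSpace E] [BorelSpace E] in
/-- `truncRadius ≥ 0`. [folklore] -/
theorem truncRadius_nonneg (x₀ c : E) (R : ℝ) : 0 ≤ truncRadius x₀ c R := by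
  unfold truncRadius; positivity

/-- The TRUNCATED KERNEL `χ Γ_a` (`χ = radialCutoff ρ₁ (ρ₁+1)`, `ρ₁ = truncRadius x₀ c R`):
integrable, compactly supported, and equal to `Γ_a` wherever it matters for the potential near
`x₀`. [folklore] -/
def truncKernel (a : ℝ) (x₀ c : E) (R : ℝ) (t : E) : ℝ :=
  Literature.Analysis.FluidPDE.radialCutoff (truncRadius x₀ c R) (truncRadius x₀ c R + 1) t * kernel a t

/-- The truncated kernel vanishes for `‖t‖ > ρ₁ + 1`. [folklore] -/
theorem truncKernel_eq_zero (a : ℝ) (x₀ c : E) (R : ℝ) {t : E}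
    (ht : truncRadius x₀ c R + 1 < ‖t‖) : truncKernel a x₀ c R t = 0 := by
  unfold truncKernel
  rw [Literature.Analysis.FluidPDE.radialCutoff_eq_zero (truncRadius_nonneg x₀ c R)
    (by linarith) ht.le, zero_mul]

/-- The kernels are integrable on balls about the origin (`a ≥ 0`, `n ≥ 3`). [folklore] -/
theorem integrableOn_kernel_ball (hn : 3 ≤ finrank ℝ E) {a : ℝ} (ha : 0 ≤ a) (r : ℝ) :
    IntegrableOn (kernel a : E → ℝ) (ball 0 r) := by
  have h2k : 2 * expo E < finrank ℝ E := by rw [two_mul_expo]; linarith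
  have hdom : IntegrableOn (fun ξ : E => (bumpMass E)⁻¹ * ‖ξ‖ ^ (-(2 * expo E))) (ball (0 : E) r) :=
    (integrableOn_ball_norm_rpow_neg hn h2k r).const_mul _
  refine hdom.mono' (measurable_kernel a).aestronglyMeasurable ?_
  rw [ae_restrict_iff' measurableSet_ball]
  filter_upwards [ae_ne hn (0 : E)] with ξ hξ _
  rw [Real.norm_eq_abs]
  calc |kernel a ξ| ≤ |kernel 0 ξ| := abs_kernel_le_abs_kernel_zero (by omega) ha hξ
    _ = (bumpMass E)⁻¹ * ‖ξ‖ ^ (-(2 * expo E)) := abs_kernel_zero_eq hn ξ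

/-- The truncated kernel is integrable (`a ≥ 0`, `n ≥ 3`). [folklore] -/
theorem integrable_truncKernel (hn : 3 ≤ finrank ℝ E) {a : ℝ} (ha : 0 ≤ a) (x₀ c : E) (R : ℝ) :
    Integrable (truncKernel a x₀ c R) := by
  set ρ₁ := truncRadius x₀ c R with hρ₁
  have h0 := truncRadius_nonneg x₀ c R
  have hsup : Function.support (truncKernel a x₀ c R) ⊆ ball (0 : E) (ρ₁ + 2) := by
    intro t ht
    rw [mem_ball_zero_iff]
    by_contra h
    exact ht (truncKernel_eq_zero a x₀ c R (by rw [← hρ₁]; linarith))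
  rw [← integrableOn_iff_integrable_of_support_subset hsup]
  have hK := integrableOn_kernel_ball hn ha (ρ₁ + 2)
  refine Integrable.bdd_mul (c := 1) hK ?_ ?_
  · exact (Literature.Analysis.FluidPDE.radialCutoff_contDiff (E' := E) (n := 0) ρ₁
      (ρ₁ + 1)).continuous.aestronglyMeasurable
  · exact Eventually.of_forall fun t => by
      rw [Real.norm_eq_abs]
      exact Literature.Analysis.FluidPDE.abs_radialCutoff_le_one _ _ t

/-- **Truncation**: for a density `h` supported in `B(c, R)` and `x ∈ B(x₀, 1)`,
`N_a h (x) = ∫ (χΓ_a)(t) h(x - t) dt`. [folklore] -/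
theorem potential_eq_integral_truncKernel (a : ℝ) {h : E → ℝ} (hsupp : ∀ z ∉ ball c R, h z = 0)
    {x₀ x : E} (hx : x ∈ ball x₀ 1) :
    potential a h x = ∫ t, truncKernel a x₀ c R t * h (x - t) := by
  rw [potential, integral_mul_comp_sub_swap]
  refine integral_congr_ae (Eventually.of_forall fun t => ?_)
  dsimp only
  by_cases ht : h (x - t) = 0
  · simp [ht]
  · have hmem : x - t ∈ ball c R := by
      by_contra hh; exact ht (hsupp _ hh)
    have hnorm : ‖t‖ ≤ truncRadius x₀ c R := by
      unfold truncRadius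
      rw [mem_ball, dist_eq_norm] at hx hmem
      have h1 : ‖t‖ ≤ ‖x‖ + ‖x - t‖ := by
        have := norm_sub_le x (x - t); rwa [sub_sub_cancel] at this
      have h2 : ‖x‖ ≤ ‖x₀‖ + ‖x - x₀‖ := norm_le_norm_add_norm_sub' x x₀
      have h3 : ‖x - t‖ ≤ ‖c‖ + ‖x - t - c‖ := norm_le_norm_add_norm_sub' (x - t) c
      have h4 : R ≤ |R| := le_abs_self R
      linarith
    unfold truncKernel
    rw [Literature.Analysis.FluidPDE.radialCutoff_eq_one (truncRadius_nonneg x₀ c R)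
      (by linarith) hnorm, one_mul, mul_comm]

omit [InnerProductSpace ℝ E] [FiniteDimensional ℝ E] [MeasurableSpace E] [BorelSpace E] in
/-- A function with `tsupport g ⊆ B(c, R)` vanishes off the ball. [folklore] -/
theorem eq_zero_of_tsupport_subset {h : E → ℝ} (hts : tsupport h ⊆ ball c R) :
    ∀ z ∉ ball c R, h z = 0 := fun _ hz =>
  image_eq_zero_of_notMem_tsupport fun h' => hz (hts h')

/-- **`N_a g ∈ C^m` for `g ∈ C^m` with `tsupport g ⊆ B(c, R)`** (`a ≥ 0`; the density carries
the derivatives after truncating the kernel). [folklore] -/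
theorem contDiff_potential_of_contDiff (hn : 3 ≤ finrank ℝ E) {a : ℝ} (ha : 0 ≤ a) {m : ℕ}
    (hgm : ContDiff ℝ m g) (hts : tsupport g ⊆ ball c R) : ContDiff ℝ m (potential a g) := by
  have hsupp := eq_zero_of_tsupport_subset hts
  refine contDiff_iff_contDiffAt.2 fun x₀ => ?_
  have hP : ContDiff ℝ m fun x => ∫ t, truncKernel a x₀ c R t * g (x - t) := by
    have := Literature.Analysis.FluidPDE.contDiff_integral_smul_comp_sub (F := ℝ)
      (integrable_truncKernel hn ha x₀ c R) (fun t ht => truncKernel_eq_zero a x₀ c R ht) m hgm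
    simpa only [smul_eq_mul] using this
  refine hP.contDiffAt.congr_of_eventuallyEq ?_
  filter_upwards [isOpen_ball.mem_nhds (mem_ball_self one_pos)] with x hx
  exact potential_eq_integral_truncKernel a hsupp hx

omit [MeasurableSpace E] [BorelSpace E] in
/-- The Laplacian of a `C²` density with `tsupport g ⊆ B(c, R)` vanishes off the ball, is
continuous and has compact support. [folklore] -/
theorem laplacian_density_props (hg2 : ContDiff ℝ 2 g) (hts : tsupport g ⊆ ball c R) :
    (∀ z ∉ ball c R, (Δ g) z = 0) ∧ Continuous (Δ g) ∧ HasCompactSupport (Δ g) := by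
  have h1 : ∀ z ∉ ball c R, (Δ g) z = 0 := fun z hz =>
    Literature.Analysis.FluidPDE.laplacian_eq_zero_of_notMem_tsupport fun h => hz (hts h)
  refine ⟨h1, Literature.Analysis.FluidPDE.continuous_laplacian hg2, ?_⟩
  exact HasCompactSupport.intro (isCompact_closedBall c R) fun z hz =>
    h1 z fun h => hz (ball_subset_closedBall h)

omit [InnerProductSpace ℝ E] [FiniteDimensional ℝ E] [MeasurableSpace E] [BorelSpace E] in
/-- A continuous compactly supported real function is bounded. [folklore] -/
theorem exists_abs_le_of_hasCompactSupport {h : E → ℝ} (hc : Continuous h)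
    (hcs : HasCompactSupport h) : ∃ M : ℝ, ∀ z, |h z| ≤ M := by
  obtain ⟨C, hC⟩ := (hcs.isCompact_range hc).isBounded.exists_norm_le
  exact ⟨C, fun z => by simpa [Real.norm_eq_abs] using hC (h z) (mem_range_self z)⟩

/-- **`Δ (N_a g) = N_a (Δ g)` for `g ∈ C²` with `tsupport g ⊆ B(c, R)`** (`a ≥ 0`). [folklore] -/
theorem laplacian_potential_of_contDiff_two (hn : 3 ≤ finrank ℝ E) {a : ℝ} (ha : 0 ≤ a)
    (hg2 : ContDiff ℝ 2 g) (hts : tsupport g ⊆ ball c R) (x₀ : E) :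
    (Δ (potential a g)) x₀ = potential a (Δ g) x₀ := by
  have hsupp := eq_zero_of_tsupport_subset hts
  obtain ⟨hΔsupp, -, -⟩ := laplacian_density_props hg2 hts
  have hk := integrable_truncKernel hn ha x₀ c R
  have hkρ := fun t ht => truncKernel_eq_zero a x₀ c R (t := t) ht
  have hev : potential a g =ᶠ[𝓝 x₀] fun x => ∫ t, truncKernel a x₀ c R t * g (x - t) := by
    filter_upwards [isOpen_ball.mem_nhds (mem_ball_self one_pos)] with x hx
    exact potential_eq_integral_truncKernel a hsupp hx
  rw [(InnerProductSpace.laplacian_congr_nhds hev).eq_of_nhds,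
    Literature.Analysis.FluidPDE.laplacian_integral_mul_comp_sub hk hkρ hg2 x₀,
    potential_eq_integral_truncKernel a hΔsupp (mem_ball_self one_pos)]

/-- The map `ε ↦ ε²` tends to `0⁺` along `0⁺`. [folklore] -/
theorem tendsto_sq_nhdsWithin_zero : Tendsto (fun ε : ℝ => ε ^ 2) (𝓝[>] 0) (𝓝[>] 0) := by
  refine tendsto_nhdsWithin_iff.2 ⟨?_, ?_⟩
  · have : Tendsto (fun ε : ℝ => ε ^ 2) (𝓝 0) (𝓝 0) := by
      simpa using (continuous_pow 2).tendsto (0 : ℝ)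
    exact this.mono_left nhdsWithin_le_nhds
  · filter_upwards [self_mem_nhdsWithin] with ε (hε : 0 < ε)
    exact pow_pos hε 2

/-- **N2 (Gilbarg–Trudinger Lemma 4.2, `C²` case). `Δ (N g) = g` for `g ∈ C²` with
`tsupport g ⊆ B(c, R)`** (`n ≥ 3`):
`Δ N g = N Δg = lim_{ε→0⁺} N_{ε²} Δg = lim Δ N_{ε²} g = lim ρ_{ε²} * g = g`.
[cite: GilbargTrudinger2001, Lemma 4.2] -/
theorem laplacian_potential_eq_self (hn : 3 ≤ finrank ℝ E) (hg2 : ContDiff ℝ 2 g)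
    (hts : tsupport g ⊆ ball c R) (x : E) : (Δ (potential 0 g)) x = g x := by
  have hsupp := eq_zero_of_tsupport_subset hts
  obtain ⟨hΔsupp, hΔc, hΔcs⟩ := laplacian_density_props hg2 hts
  obtain ⟨MΔ, hMΔ⟩ := exists_abs_le_of_hasCompactSupport hΔc hΔcs
  have hΔi : Integrable (Δ g) := hΔc.integrable_of_hasCompactSupport hΔcs
  -- the density itself
  have hgc : Continuous g := hg2.continuous
  have hgcs : HasCompactSupport g :=
    HasCompactSupport.intro (isCompact_closedBall c R) fun z hz =>
      hsupp z fun h => hz (ball_subset_closedBall h)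
  obtain ⟨M, hM⟩ := exists_abs_le_of_hasCompactSupport hgc hgcs
  have hgi : Integrable g := hgc.integrable_of_hasCompactSupport hgcs
  have hgu : UniformContinuous g := hgcs.uniformContinuous_of_continuous hgc
  -- Step A
  rw [laplacian_potential_of_contDiff_two hn le_rfl hg2 hts x]
  -- Step B: `N_{ε²} Δg (x) → N Δg (x)`
  have hB : Tendsto (fun ε : ℝ => potential (ε ^ 2) (Δ g) x) (𝓝[>] 0)
      (𝓝 (potential 0 (Δ g) x)) :=
    (tendsto_potential hn hΔi hMΔ hΔsupp x).comp tendsto_sq_nhdsWithin_zero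
  -- Step D: `ρ_{ε²} * g (x) → g x`
  have hD := tendsto_integral_mul_approxId hn hgc hgu hM x
  -- Step C: the two families agree for `ε > 0`
  have hC : (fun ε : ℝ => potential (ε ^ 2) (Δ g) x) =ᶠ[𝓝[>] 0]
      fun ε : ℝ => ∫ z, g z * approxId (ε ^ 2) (x - z) := by
    filter_upwards [self_mem_nhdsWithin] with ε (hε : 0 < ε)
    have hε2 : 0 < ε ^ 2 := pow_pos hε 2
    rw [← laplacian_potential_of_contDiff_two hn hε2.le hg2 hts x,
      laplacian_potential_pos hε2 hgi hsupp x]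
  exact tendsto_nhds_unique (hB.congr' hC) hD

/-- **N3. `N g ∈ C²(E)` for `g ∈ C¹` with `tsupport g ⊆ B(c, R)`** (`n ≥ 3`): the directional
derivatives `∂ᵥ N g = N (∂ᵥ g)` are `C¹` by N1. [folklore] -/
theorem contDiff_two_potential (hn : 3 ≤ finrank ℝ E) (hg1 : ContDiff ℝ 1 g)
    (hts : tsupport g ⊆ ball c R) : ContDiff ℝ 2 (potential 0 g) := by
  have hsupp := eq_zero_of_tsupport_subset hts
  have hP1 : ContDiff ℝ 1 (potential 0 g) := contDiff_potential_of_contDiff hn le_rfl hg1 hts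
  have h2 : (2 : WithTop ℕ∞) = 1 + 1 := by norm_num
  rw [h2, contDiff_succ_iff_fderiv_apply]
  refine ⟨hP1.differentiable one_ne_zero, fun h => absurd h WithTop.one_ne_top, fun v => ?_⟩
  -- the directional derivative density `∂ᵥ g`
  set h : E → ℝ := fun w => fderiv ℝ g w v with hh
  have hhc : Continuous h := (hg1.continuous_fderiv one_ne_zero).clm_apply continuous_const
  have hhts : tsupport h ⊆ ball c R := by
    refine Subset.trans (closure_mono fun w hw => ?_) ((tsupport_fderiv_subset ℝ (f := g)).trans hts)
    rw [mem_support] at hw ⊢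
    intro h0
    exact hw (by simp [hh, h0])
  have hhsupp := eq_zero_of_tsupport_subset hhts
  have hhcs : HasCompactSupport h :=
    HasCompactSupport.intro (isCompact_closedBall c R) fun z hz =>
      hhsupp z fun h' => hz (ball_subset_closedBall h')
  obtain ⟨Mh, hMh⟩ := exists_abs_le_of_hasCompactSupport hhc hhcs
  have hhi : Integrable h := hhc.integrable_of_hasCompactSupport hhcs
  have hN1 : ContDiff ℝ 1 (potential 0 h) := contDiff_one_potential hn hhi hMh hhsupp
  have heq : (fun x => fderiv ℝ (potential 0 g) x v) = potential 0 h := by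
    funext x₀
    have hk := integrable_truncKernel hn le_rfl x₀ c R
    have hkρ := fun t ht => truncKernel_eq_zero 0 x₀ c R (t := t) ht
    have hev : potential 0 g =ᶠ[𝓝 x₀] fun x => ∫ t, truncKernel 0 x₀ c R t • g (x - t) := by
      filter_upwards [isOpen_ball.mem_nhds (mem_ball_self one_pos)] with x hx
      simpa only [smul_eq_mul] using potential_eq_integral_truncKernel 0 hsupp hx
    rw [hev.fderiv_eq,
      Literature.Analysis.FluidPDE.fderiv_integral_smul_comp_sub_apply (F := ℝ) hk hkρ hg1 x₀ v,
      potential_eq_integral_truncKernel 0 hhsupp (mem_ball_self one_pos)]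
    simp only [hh, smul_eq_mul]
  rw [heq]
  exact hN1

end N2

end Newtonian

end Literature.Analysis.PDE
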